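import Summits.AtomisticToContinuum.HydrodynamicLimit.Theorems.CollisionIsometryCLTAdaptedWeightCLTTLColumnDepolarisationFloor
import Summits.AtomisticToContinuum.HydrodynamicLimit.Theorems.CollisionIsometryCLTAdaptedWeightCLTTLColumnDepolarisationMeasurable
import Summits.AtomisticToContinuum.HydrodynamicLimit.Theorems.CollisionIsometryCLTAdaptedWeightCLTTLColumnDepolarisationRate
import Literature.MathematicalPhysics.KineticTheory.HardSphereEulerProofs

/-!
# Stub `stub_columnDepolarisation` (v2) of the line `contact-source-duhamel`
(crux `CollisionIsometryCLT.AdaptedWeightCLT`, stmt-AtomisticToContinuum-14868 = rev-12 TIME-LOCAL crux;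
`--supports`; file 3/3 of the v2 stub: the mechanism and the integration)

COLUMN DEPOLARISATION ALONG THE LINE WINDOW from H1, its incoherent twin, the collision rate and
one-step non-degeneracy: `NiceProfiles → ∃ σ₀ > 0, ∀ σ < σ₀, ∀ Φ, DiffuseAt → IncoherentDiffuseAt →
ManyCollisionsAt → OneStepNondegenerateAt → CDAlongAt` (registered signature; `σ₀ = 1/2`, the
regularity threshold of the torus geometry; `DiffuseAt` is not used — its role is taken by the three
typed inputs of `…Balance`/`…Rate`, all read at the same window start `y = Φ_{t−Δℓ_N} z` under the same
local Gibbs law, so no flow/dictionary fact enters).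

1. THE MECHANISM (pathwise, `anisF_le_of_osn`). Let `m` be the number of fold steps of the window,
   `mh` that of its first half, `K ≥ 1`, `J = K(N+1) ≤ m − mh`, and let `E` bound the OSN errors
   `c₀ (N+1)⁻¹ Σ_{m−j ≤ s < m} anisF s − workF (m−j) m` for `j ≤ J`. The balance
   (`anisF_telescope`) on the last `J` steps, `0 ≤ anisF ≤ 6` and the floor `quadF ≤ ½ pairPartF ≤ ½ P`
   (`P` the pair participation of the second half) give `2c₀ (N+1)⁻¹ Σ_{last J} anisF ≤ 6 + 2E + ½P`,
   so some step `s₀` of the last `J` has `anisF s₀ ≤ (6 + 2E + ½P)/(2c₀K)` (pigeonhole); the balance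
   from `s₀` on and OSN at `j = m − s₀` give `cd2 = anisF m ≤ anisF s₀ + 2E + ½P`, whence
   `cd2 ≤ 3/(c₀K) + (c₀⁻¹+2) E + (c₀⁻¹+1) P`.
2. INTEGRATION (`lintegral_cd_le`, fixed `N`). With `cd3x ≤ 3 carrPartF` (`…Floor`) and
   `0 ≤ cd2 + cd3x ≤ 84` (`…Bounds`) off the event `{m < mh + K(N+1)}`:
   `E[cd2 + cd3x] ≤ 3/(c₀K) + C·E[osnErr] + C·E[carrPartF + pairPartF] + 84·P(few collisions)`,
   `C = c₀⁻¹ + 3`, by monotonicity and additivity of the lower integral — the two middle integrands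
   are measurable (`…Measurable`), the local Gibbs law is a probability measure
   (`isProbabilityMeasure_localGibbsLaw`).
3. LIMIT. For `ε > 0` pick `K` with `3/(c₀K) ≤ ε/2`; the three inputs make the rest `≤ ε/2`
   eventually (`ENNReal.tendsto_nhds_zero`).
-/

namespace Summit.AtomisticToContinuum.HydrodynamicLimit.Theorems.ContactSourceDuhamel.TimeLocal
namespace ColumnDepolarisation

open scoped BigOperators Topology Classical MeasureTheory ENNReal InnerProductSpace
open Filter Set MeasureTheory
open Literature.Analysis.FluidPDE
open Literature.MathematicalPhysics.KineticTheory (hsDiameter hsDiameter_le localGibbsLaw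
  isProbabilityMeasure_localGibbsLaw)

noncomputable section

variable {σ : ℝ} {N : ℕ} {y : Cfg N}

/-! ## A-priori bound and monotonicity of the balance functionals -/

/-- `anisF ≤ 6` at every step count (nine unit probes per injection site, each cloud within `2/3` of
isotropy in squared Frobenius distance). -/
theorem anisF_le_six (s : ℕ) : anisF σ N y s ≤ 6 := by
  unfold anisF
  have hb : ∀ (k : Fin (N + 1)) (p q : Fin 3), normSqT (anisT σ N y k (dirV p q) s) ≤ 2 / 3 := by
    intro k p q
    have h := normSqT_cloud_two_sub_iso2_le (σ := σ) (y := y) s k (dirV p q)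
    rw [norm_dirV] at h
    norm_num at h
    exact h
  calc ((N + 1 : ℕ) : ℝ)⁻¹ * ∑ k : Fin (N + 1), ∑ p : Fin 3, ∑ q : Fin 3,
          normSqT (anisT σ N y k (dirV p q) s)
        ≤ ((N + 1 : ℕ) : ℝ)⁻¹ * ∑ _k : Fin (N + 1), ∑ _p : Fin 3, ∑ _q : Fin 3, (2 / 3 : ℝ) := by
          gcongr with k _ p _ q _
          exact hb k p q
    _ = 6 := by
          simp only [Finset.sum_const, Finset.card_univ, Fintype.card_fin, nsmul_eq_mul]
          push_cast
          field_simp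
          ring

/-- The pair participation over a stretch grows with the stretch (left endpoint). -/
theorem pairPartF_anti_left {m₁ m₁' m₂ : ℕ} (h : m₁' ≤ m₁) :
    pairPartF σ N y m₁ m₂ ≤ pairPartF σ N y m₁' m₂ := by
  unfold pairPartF
  refine mul_le_mul_of_nonneg_left ?_ (inv_nonneg.2 (Nat.cast_nonneg _))
  refine Finset.sum_le_sum fun k _ => Finset.sum_le_sum fun p _ => Finset.sum_le_sum fun q _ => ?_
  exact Finset.sum_le_sum_of_subset_of_nonneg (Finset.Ico_subset_Ico h le_rfl)
    fun _ _ _ => sq_nonneg _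

/-! ## The mechanism: one-step non-degeneracy on a long final stretch depolarises -/

/-- **THE DEPOLARISATION MECHANISM (pathwise).** If the window has at least `K(N+1)` fold steps after
its first half (`mh + K(N+1) ≤ m`) and `E` bounds the one-sided OSN errors
`c₀ (N+1)⁻¹ Σ_{m−j ≤ s < m} anisF s − workF (m−j) m` on all final stretches of length `j ≤ K(N+1)`, then
`anisF m ≤ 3/(c₀K) + (c₀⁻¹ + 2) E + (c₀⁻¹ + 1) · pairPartF mh m`. -/
theorem anisF_le_of_osn {c₀ E : ℝ} (hc : 0 < c₀) {K : ℕ} (hK : 0 < K) {mh m : ℕ}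
    (hm : mh + K * (N + 1) ≤ m)
    (hE : ∀ j ≤ K * (N + 1), c₀ * ((N + 1 : ℕ) : ℝ)⁻¹ * ∑ s ∈ Finset.Ico (m - j) m, anisF σ N y s -
      workF σ N y (m - j) m ≤ E) :
    anisF σ N y m ≤ 3 / (c₀ * K) + (c₀⁻¹ + 2) * E + (c₀⁻¹ + 1) * pairPartF σ N y mh m := by
  -- notation and signs
  set J := K * (N + 1) with hJ
  set n1 : ℝ := ((N + 1 : ℕ) : ℝ) with hn1
  set P := pairPartF σ N y mh m with hP
  have hn1pos : 0 < n1 := by rw [hn1]; positivity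
  have hKpos : (0 : ℝ) < K := Nat.cast_pos.2 hK
  have hK1 : (1 : ℝ) ≤ K := by exact_mod_cast hK
  have hJpos : 0 < J := Nat.mul_pos hK (Nat.succ_pos N)
  have hJm : J ≤ m := le_trans (Nat.le_add_left _ _) hm
  have hmh : mh ≤ m - J := by omega
  have hJreal : (J : ℝ) = K * n1 := by rw [hJ, hn1]; push_cast; ring
  have hE0 : 0 ≤ E := by
    have h := hE 0 (Nat.zero_le _)
    simpa [workF_self] using h
  have hP0 : 0 ≤ P := pairPartF_nonneg mh m
  -- the floor on any final stretch inside the last `J` steps is at most `P/2`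
  have hQ : ∀ s', m - J ≤ s' → quadF σ N y s' m ≤ 2⁻¹ * P := by
    intro s' hs'
    calc quadF σ N y s' m ≤ 1 / 2 * pairPartF σ N y s' m := quadF_le_half_pairPartF s' m
      _ ≤ 1 / 2 * P := by
          refine mul_le_mul_of_nonneg_left ?_ (by norm_num)
          exact pairPartF_anti_left (hmh.trans hs')
      _ = 2⁻¹ * P := by norm_num
  -- step 1: the balance on the last `J` steps bounds the summed anisotropy
  set S := ∑ s ∈ Finset.Ico (m - J) m, anisF σ N y s with hS
  have hsum : 2 * c₀ * n1⁻¹ * S ≤ 6 + 2 * E + 2⁻¹ * P := by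
    have hbal := anisF_telescope (σ := σ) (N := N) (y := y) (Nat.sub_le m J)
    have hEJ := hE J le_rfl
    have h6 := anisF_le_six (σ := σ) (N := N) (y := y) (m - J)
    have h0 := anisF_nonneg (σ := σ) (N := N) (y := y) m
    have hq := hQ (m - J) le_rfl
    linarith
  -- step 2: pigeonhole — a step of the last `J` with anisotropy below the mean
  have hcard : (Finset.Ico (m - J) m).card = J := by
    rw [Nat.card_Ico]
    omega
  have hne : (Finset.Ico (m - J) m).Nonempty := by
    rw [← Finset.card_pos, hcard]
    exact hJpos
  have hJne : (J : ℝ) ≠ 0 := by exact_mod_cast hJpos.ne'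
  obtain ⟨s₀, hs₀, hle⟩ : ∃ s₀ ∈ Finset.Ico (m - J) m, anisF σ N y s₀ ≤ S / J := by
    refine Finset.exists_le_of_sum_le hne ?_
    rw [Finset.sum_const, hcard, nsmul_eq_mul, mul_div_cancel₀ _ hJne]
  rw [Finset.mem_Ico] at hs₀
  -- step 3: the balance from `s₀` on
  have hA : anisF σ N y m ≤ S / J + 2 * E + 2⁻¹ * P := by
    have hbal₀ := anisF_telescope (σ := σ) (N := N) (y := y) hs₀.2.le
    have hE₀ := hE (m - s₀) (by omega)
    rw [show m - (m - s₀) = s₀ by omega] at hE₀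
    have hS₀ : 0 ≤ c₀ * n1⁻¹ * ∑ s ∈ Finset.Ico s₀ m, anisF σ N y s :=
      mul_nonneg (mul_nonneg hc.le (inv_nonneg.2 hn1pos.le))
        (Finset.sum_nonneg fun s _ => anisF_nonneg s)
    have hq₀ := hQ s₀ hs₀.1
    linarith
  -- step 4: arithmetic
  have hSJ : S / J ≤ (6 + 2 * E + 2⁻¹ * P) / (2 * c₀ * K) := by
    have h1 : 2 * c₀ * S ≤ (6 + 2 * E + 2⁻¹ * P) * n1 := by
      have h := mul_le_mul_of_nonneg_right hsum hn1pos.le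
      rwa [show 2 * c₀ * n1⁻¹ * S * n1 = 2 * c₀ * S by field_simp] at h
    rw [hJreal, div_le_div_iff₀ (by positivity) (by positivity)]
    nlinarith [h1, hKpos]
  have hw : (c₀ * K)⁻¹ ≤ c₀⁻¹ := inv_anti₀ hc (le_mul_of_one_le_right hc.le hK1)
  have hsplit : (6 + 2 * E + 2⁻¹ * P) / (2 * c₀ * K) =
      3 / (c₀ * K) + (c₀ * K)⁻¹ * E + (c₀ * K)⁻¹ * (P / 4) := by
    field_simp
    ring
  have h1 : (c₀ * K)⁻¹ * E ≤ c₀⁻¹ * E := mul_le_mul_of_nonneg_right hw hE0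
  have h2 : (c₀ * K)⁻¹ * (P / 4) ≤ c₀⁻¹ * P := by
    calc (c₀ * K)⁻¹ * (P / 4) ≤ c₀⁻¹ * (P / 4) := mul_le_mul_of_nonneg_right hw (by positivity)
      _ ≤ c₀⁻¹ * P := by
          refine mul_le_mul_of_nonneg_left ?_ (inv_nonneg.2 hc.le)
          linarith
  have h3 : 0 ≤ c₀⁻¹ * P := mul_nonneg (inv_nonneg.2 hc.le) hP0
  calc anisF σ N y m ≤ (6 + 2 * E + 2⁻¹ * P) / (2 * c₀ * K) + 2 * E + 2⁻¹ * P := by linarith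
    _ = 3 / (c₀ * K) + (c₀ * K)⁻¹ * E + (c₀ * K)⁻¹ * (P / 4) + 2 * E + 2⁻¹ * P := by rw [hsplit]
    _ ≤ 3 / (c₀ * K) + c₀⁻¹ * E + c₀⁻¹ * P + 2 * E + 2⁻¹ * P := by linarith
    _ ≤ 3 / (c₀ * K) + (c₀⁻¹ + 2) * E + (c₀⁻¹ + 1) * P := by nlinarith

/-- **The pathwise bound on the good event.** At a window start `y` with at least `K(N+1)` fold steps
in the second half of the line window, `cd2 + cd3x ≤ 3/(c₀K) + C·osnErr + C·(carrPartF + pairPartF)`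
with `C = c₀⁻¹ + 3`, `osnErr` the OSN integrand (a finite supremum over the final stretches). -/
theorem cd2_add_cd3x_le_of_osn {c₀ : ℝ} (hc : 0 < c₀) {K : ℕ} (hK : 0 < K)
    (hgood : steps σ N y (Δℓ N / 2) + K * (N + 1) ≤ steps σ N y (Δℓ N)) :
    cd2 σ N y (Δℓ N) + cd3x σ N y (Δℓ N) ≤ 3 / (c₀ * K) +
      (c₀⁻¹ + 3) * (⨆ j : Fin (K * (N + 1) + 1),
        (c₀ * ((N + 1 : ℕ) : ℝ)⁻¹ *
            ∑ s ∈ Finset.Ico (steps σ N y (Δℓ N) - (j : ℕ)) (steps σ N y (Δℓ N)), anisF σ N y s -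
          workF σ N y (steps σ N y (Δℓ N) - (j : ℕ)) (steps σ N y (Δℓ N)))) +
      (c₀⁻¹ + 3) * (carrPartF σ N y (steps σ N y (Δℓ N)) +
        pairPartF σ N y (steps σ N y (Δℓ N / 2)) (steps σ N y (Δℓ N))) := by
  have h3 := cd3x_le_carrPartF σ N y (Δℓ N)
  rw [cd2_eq_anisF]
  set m := steps σ N y (Δℓ N) with hm
  set mh := steps σ N y (Δℓ N / 2) with hmh
  set E := ⨆ j : Fin (K * (N + 1) + 1), (c₀ * ((N + 1 : ℕ) : ℝ)⁻¹ *
    ∑ s ∈ Finset.Ico (m - (j : ℕ)) m, anisF σ N y s - workF σ N y (m - (j : ℕ)) m) with hEdef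
  have hE : ∀ j ≤ K * (N + 1), c₀ * ((N + 1 : ℕ) : ℝ)⁻¹ * ∑ s ∈ Finset.Ico (m - j) m, anisF σ N y s -
      workF σ N y (m - j) m ≤ E := fun j hj => by
    rw [hEdef]
    exact le_ciSup (f := fun j' : Fin (K * (N + 1) + 1) => c₀ * ((N + 1 : ℕ) : ℝ)⁻¹ *
      ∑ s ∈ Finset.Ico (m - (j' : ℕ)) m, anisF σ N y s - workF σ N y (m - (j' : ℕ)) m)
      (Finite.bddAbove_range _) ⟨j, Nat.lt_succ_of_le hj⟩
  have hA := anisF_le_of_osn hc hK hgood hE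
  have hE0 : 0 ≤ E := by
    have h := hE 0 (Nat.zero_le _)
    simpa [workF_self] using h
  have hP0 := pairPartF_nonneg (σ := σ) (N := N) (y := y) mh m
  have hC0 := carrPartF_nonneg (σ := σ) (N := N) (y := y) m
  have hci : 0 ≤ c₀⁻¹ := inv_nonneg.2 hc.le
  nlinarith [mul_nonneg hci hC0, mul_nonneg hci hP0]

/-! ## Integration at fixed `N` -/

/-- **Integrating the mechanism against a probability measure** (fixed `N`, regular diameter): the
mean of `cd2 + cd3x` at the window start `Φ_τ z` is at most `3/(c₀K)` plus `C = c₀⁻¹ + 3` times the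
means of the OSN integrand and of the incoherent-participation integrand plus `84` times the
probability of fewer than `K(N+1)` fold steps in the second half of the window. -/
theorem lintegral_cd_le (hG : (Torus.geometry (Fin 3)).IsHardSphereRegular (hsDiameter σ N))
    (Φ : Flow σ N) (μ : Measure (Cfg N)) [IsProbabilityMeasure μ] (τ : ℝ) {c₀ : ℝ} (hc : 0 < c₀)
    {K : ℕ} (hK : 0 < K) :
    ∫⁻ z, ENNReal.ofReal (cd2 σ N (Φ.flow τ z) (Δℓ N) + cd3x σ N (Φ.flow τ z) (Δℓ N)) ∂μ ≤
      ENNReal.ofReal (3 / (c₀ * K)) +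
        (ENNReal.ofReal (c₀⁻¹ + 3) * ∫⁻ z, ENNReal.ofReal (⨆ j : Fin (K * (N + 1) + 1),
            (c₀ * ((N + 1 : ℕ) : ℝ)⁻¹ *
                ∑ s ∈ Finset.Ico (steps σ N (Φ.flow τ z) (Δℓ N) - (j : ℕ))
                  (steps σ N (Φ.flow τ z) (Δℓ N)), anisF σ N (Φ.flow τ z) s -
              workF σ N (Φ.flow τ z) (steps σ N (Φ.flow τ z) (Δℓ N) - (j : ℕ))
                (steps σ N (Φ.flow τ z) (Δℓ N)))) ∂μ +
          ENNReal.ofReal (c₀⁻¹ + 3) * ∫⁻ z, ENNReal.ofReal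
            (carrPartF σ N (Φ.flow τ z) (steps σ N (Φ.flow τ z) (Δℓ N)) +
              pairPartF σ N (Φ.flow τ z) (steps σ N (Φ.flow τ z) (Δℓ N / 2))
                (steps σ N (Φ.flow τ z) (Δℓ N))) ∂μ +
          84 * μ {z | steps σ N (Φ.flow τ z) (Δℓ N) <
            steps σ N (Φ.flow τ z) (Δℓ N / 2) + K * (N + 1)}) := by
  -- names for the three integrands and the bad event
  set osn : Cfg N → ℝ := fun y => ⨆ j : Fin (K * (N + 1) + 1),
    (c₀ * ((N + 1 : ℕ) : ℝ)⁻¹ * ∑ s ∈ Finset.Ico (steps σ N y (Δℓ N) - (j : ℕ)) (steps σ N y (Δℓ N)),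
      anisF σ N y s - workF σ N y (steps σ N y (Δℓ N) - (j : ℕ)) (steps σ N y (Δℓ N))) with hosn
  set idf : Cfg N → ℝ := fun y => carrPartF σ N y (steps σ N y (Δℓ N)) +
    pairPartF σ N y (steps σ N y (Δℓ N / 2)) (steps σ N y (Δℓ N)) with hidf
  set bad : Set (Cfg N) := {z | steps σ N (Φ.flow τ z) (Δℓ N) <
    steps σ N (Φ.flow τ z) (Δℓ N / 2) + K * (N + 1)} with hbad
  set C : ℝ := c₀⁻¹ + 3 with hC
  have hCpos : 0 ≤ C := by rw [hC]; positivity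
  -- measurability of the two middle integrands
  have hmo : Measurable fun z => ENNReal.ofReal (osn (Φ.flow τ z)) :=
    measurable_osnIntegrand_flow hG Φ τ c₀ K (Δℓ N)
  have hmi : Measurable fun z => ENNReal.ofReal (idf (Φ.flow τ z)) :=
    measurable_incoherentIntegrand_flow hG Φ τ (Δℓ N) (Δℓ N / 2)
  have hmo' : Measurable fun z => ENNReal.ofReal C * ENNReal.ofReal (osn (Φ.flow τ z)) :=
    hmo.const_mul _
  have hmi' : Measurable fun z => ENNReal.ofReal C * ENNReal.ofReal (idf (Φ.flow τ z)) :=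
    hmi.const_mul _
  have hms : Measurable fun z => ENNReal.ofReal C * ENNReal.ofReal (osn (Φ.flow τ z)) +
      ENNReal.ofReal C * ENNReal.ofReal (idf (Φ.flow τ z)) := hmo'.add hmi'
  -- the pointwise bound
  have hpt : ∀ z, ENNReal.ofReal (cd2 σ N (Φ.flow τ z) (Δℓ N) + cd3x σ N (Φ.flow τ z) (Δℓ N)) ≤
      ENNReal.ofReal (3 / (c₀ * K)) +
        ((ENNReal.ofReal C * ENNReal.ofReal (osn (Φ.flow τ z)) +
          ENNReal.ofReal C * ENNReal.ofReal (idf (Φ.flow τ z))) + 84 * bad.indicator 1 z) := by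
    intro z
    by_cases hz : z ∈ bad
    · rw [indicator_of_mem hz, Pi.one_apply, mul_one]
      have h84 : cd2 σ N (Φ.flow τ z) (Δℓ N) + cd3x σ N (Φ.flow τ z) (Δℓ N) ≤ 84 := by
        linarith [cd2_le_six σ N (Φ.flow τ z) (Δℓ N), cd3x_le σ N (Φ.flow τ z) (Δℓ N)]
      calc ENNReal.ofReal (cd2 σ N (Φ.flow τ z) (Δℓ N) + cd3x σ N (Φ.flow τ z) (Δℓ N))
            ≤ ENNReal.ofReal 84 := ENNReal.ofReal_le_ofReal h84
        _ = 84 := by norm_num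
        _ ≤ _ := le_add_left (le_add_left le_rfl)
    · have hgood : steps σ N (Φ.flow τ z) (Δℓ N / 2) + K * (N + 1) ≤ steps σ N (Φ.flow τ z) (Δℓ N) := by
        rw [hbad] at hz
        simpa using hz
      have hreal := cd2_add_cd3x_le_of_osn (σ := σ) (y := Φ.flow τ z) hc hK hgood
      calc ENNReal.ofReal (cd2 σ N (Φ.flow τ z) (Δℓ N) + cd3x σ N (Φ.flow τ z) (Δℓ N))
            ≤ ENNReal.ofReal (3 / (c₀ * K) + C * osn (Φ.flow τ z) + C * idf (Φ.flow τ z)) :=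
              ENNReal.ofReal_le_ofReal hreal
        _ ≤ ENNReal.ofReal (3 / (c₀ * K)) +
              (ENNReal.ofReal (C * osn (Φ.flow τ z)) + ENNReal.ofReal (C * idf (Φ.flow τ z))) := by
              rw [← add_assoc]
              exact ENNReal.ofReal_add_le.trans (add_le_add ENNReal.ofReal_add_le le_rfl)
        _ = ENNReal.ofReal (3 / (c₀ * K)) +
              (ENNReal.ofReal C * ENNReal.ofReal (osn (Φ.flow τ z)) +
                ENNReal.ofReal C * ENNReal.ofReal (idf (Φ.flow τ z))) := by
              rw [ENNReal.ofReal_mul hCpos, ENNReal.ofReal_mul hCpos]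
        _ ≤ _ := add_le_add le_rfl (le_add_right le_rfl)
  -- integrate
  calc ∫⁻ z, ENNReal.ofReal (cd2 σ N (Φ.flow τ z) (Δℓ N) + cd3x σ N (Φ.flow τ z) (Δℓ N)) ∂μ
      ≤ ∫⁻ z, (ENNReal.ofReal (3 / (c₀ * K)) +
          ((ENNReal.ofReal C * ENNReal.ofReal (osn (Φ.flow τ z)) +
            ENNReal.ofReal C * ENNReal.ofReal (idf (Φ.flow τ z))) + 84 * bad.indicator 1 z)) ∂μ :=
        lintegral_mono hpt
    _ = ENNReal.ofReal (3 / (c₀ * K)) +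
          ((ENNReal.ofReal C * ∫⁻ z, ENNReal.ofReal (osn (Φ.flow τ z)) ∂μ +
            ENNReal.ofReal C * ∫⁻ z, ENNReal.ofReal (idf (Φ.flow τ z)) ∂μ) +
            84 * ∫⁻ z, bad.indicator 1 z ∂μ) := by
        rw [lintegral_add_left measurable_const, lintegral_const, measure_univ, mul_one,
          lintegral_add_left hms, lintegral_add_left hmo', lintegral_const_mul _ hmo,
          lintegral_const_mul _ hmi, lintegral_const_mul' _ _ (by norm_num)]
    _ ≤ _ := by
        gcongr
        exact lintegral_indicator_one_le _

/-! ## The stub -/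

/-- **COLUMN DEPOLARISATION** (`stub_columnDepolarisation` of the line `contact-source-duhamel`, v2,
registered signature): for nice profiles and `0 < σ < 1/2`, H1 together with its incoherent twin, the
collision-rate input and one-step non-degeneracy along the line window imply `CDAlongAt`: the
local-Gibbs mean of `cd2 + cd3x` over `[t − Δℓ_N, t]` tends to `0` for every `t > 0`. See the module
docstring for the proof; `DiffuseAt` itself is not used. -/
theorem stub_columnDepolarisation : ∀ (a₀ θ₀ : T3 → ℝ) (u₀ : T3 → V3), NiceProfiles a₀ θ₀ u₀ → ∃ σ₀ : ℝ, 0 < σ₀ ∧ ∀ σ : ℝ, 0 < σ → σ < σ₀ → ∀ Φ : Flows σ, DiffuseAt σ a₀ θ₀ u₀ Φ → IncoherentDiffuseAt σ a₀ θ₀ u₀ Φ → ManyCollisionsAt σ a₀ θ₀ u₀ Φ → OneStepNondegenerateAt σ a₀ θ₀ u₀ Φ → CDAlongAt σ a₀ θ₀ u₀ Φ := by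
  intro a₀ θ₀ u₀ hP
  refine ⟨2⁻¹, by norm_num, fun σ hσ hσ2 Φ _ hID hMC hOSN => ?_⟩
  intro t ht
  obtain ⟨c₀, hc₀, hOSN⟩ := hOSN
  have hσhalf : σ ≤ 1 / 2 := by
    rw [one_div]
    exact hσ2.le
  haveI hprob : ∀ N, IsProbabilityMeasure (localGibbsLaw σ a₀ u₀ θ₀ N (Φ N)) := fun N =>
    isProbabilityMeasure_localGibbsLaw hP.1 hP.2.1 hP.2.2.1 hP.2.2.2.1 hP.2.2.2.2 hσhalf N (Φ N)
  have hG : ∀ N, (Torus.geometry (Fin 3)).IsHardSphereRegular (hsDiameter σ N) := fun N =>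
    Torus.isHardSphereRegular_geometry ((hsDiameter_le hσ.le N).trans_lt hσ2)
  rw [ENNReal.tendsto_nhds_zero]
  intro ε hε
  have hε2 : 0 < ε / 2 := ENNReal.half_pos hε.ne'
  -- choose `K` with `3/(c₀K) ≤ ε/2`
  have hKlim : Tendsto (fun K : ℕ => ENNReal.ofReal (3 / (c₀ * K))) atTop (𝓝 0) := by
    have h : Tendsto (fun K : ℕ => 3 / c₀ / (K : ℝ)) atTop (𝓝 0) :=
      tendsto_const_div_atTop_nhds_zero_nat (3 / c₀)
    have h' := ENNReal.tendsto_ofReal h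
    rw [ENNReal.ofReal_zero] at h'
    refine h'.congr fun K => ?_
    rw [div_div]
  obtain ⟨K, hKε, hK⟩ := ((ENNReal.tendsto_nhds_zero.1 hKlim (ε / 2) hε2).and
    (eventually_gt_atTop 0)).exists
  -- the three inputs at `K`, `t`
  have h1 := hID t ht
  have h2 := hMC K t ht
  have h3 := hOSN K t ht
  -- the tail `C·E[osn] + C·E[id] + 84·P(bad)` tends to `0`
  have htail : Tendsto (fun N : ℕ =>
      ENNReal.ofReal (c₀⁻¹ + 3) * (∫⁻ z, ENNReal.ofReal (⨆ j : Fin (K * (N + 1) + 1),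
          (c₀ * ((N + 1 : ℕ) : ℝ)⁻¹ *
              ∑ s ∈ Finset.Ico (steps σ N ((Φ N).flow (t - Δℓ N) z) (Δℓ N) - (j : ℕ))
                (steps σ N ((Φ N).flow (t - Δℓ N) z) (Δℓ N)), anisF σ N ((Φ N).flow (t - Δℓ N) z) s -
            workF σ N ((Φ N).flow (t - Δℓ N) z) (steps σ N ((Φ N).flow (t - Δℓ N) z) (Δℓ N) - (j : ℕ))
              (steps σ N ((Φ N).flow (t - Δℓ N) z) (Δℓ N))))
          ∂(localGibbsLaw σ a₀ u₀ θ₀ N (Φ N))) +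
        ENNReal.ofReal (c₀⁻¹ + 3) * (∫⁻ z, ENNReal.ofReal
          (carrPartF σ N ((Φ N).flow (t - Δℓ N) z) (steps σ N ((Φ N).flow (t - Δℓ N) z) (Δℓ N)) +
            pairPartF σ N ((Φ N).flow (t - Δℓ N) z)
              (steps σ N ((Φ N).flow (t - Δℓ N) z) (Δℓ N / 2))
              (steps σ N ((Φ N).flow (t - Δℓ N) z) (Δℓ N)))
          ∂(localGibbsLaw σ a₀ u₀ θ₀ N (Φ N))) +
        84 * localGibbsLaw σ a₀ u₀ θ₀ N (Φ N)
          {z | steps σ N ((Φ N).flow (t - Δℓ N) z) (Δℓ N) <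
            steps σ N ((Φ N).flow (t - Δℓ N) z) (Δℓ N / 2) + K * (N + 1)}) atTop (𝓝 0) := by
    have h := ((ENNReal.Tendsto.const_mul (a := ENNReal.ofReal (c₀⁻¹ + 3)) h3
      (Or.inr ENNReal.ofReal_ne_top)).add
      (ENNReal.Tendsto.const_mul (a := ENNReal.ofReal (c₀⁻¹ + 3)) h1
        (Or.inr ENNReal.ofReal_ne_top))).add
      (ENNReal.Tendsto.const_mul (a := (84 : ℝ≥0∞)) h2 (Or.inr (by norm_num)))
    simp only [mul_zero, add_zero] at h
    exact h
  filter_upwards [ENNReal.tendsto_nhds_zero.1 htail (ε / 2) hε2] with N hN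
  calc _ ≤ _ := lintegral_cd_le (hG N) (Φ N) (localGibbsLaw σ a₀ u₀ θ₀ N (Φ N)) (t - Δℓ N) hc₀ hK
    _ ≤ ε / 2 + ε / 2 := add_le_add hKε hN
    _ = ε := ENNReal.add_halves ε

end

end ColumnDepolarisation
end Summit.AtomisticToContinuum.HydrodynamicLimit.Theorems.ContactSourceDuhamel.TimeLocal
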